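import Summits.RiemannHypothesis.RiemannHypothesis.Theorems.HandoffMarginLaw
import Summits.RiemannHypothesis.RiemannHypothesis.Theorems.SoloInformedSizeLaw
import Summits.RiemannHypothesis.RiemannHypothesis.Theorems.SoloInformedNonDegenerate
import HarnessLib

/-!
# Slot E-1, the ENERGY margin: which margin laws are RH-equivalent, and the unconditional ceiling

Cell `rh-explicit`, TRACK «HANDOFF», seat handoff-theory-1 (definitions + logic), gen4.  Companion text:
`HOME/handoff/HANDOFF-STATEMENT.md` §E (slot E-1) and §J.11 (2).  Builds on theory-2's `HandoffMarginLaw.lean`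
(`HandoffEnergyMargin m := ∀ q prime, m q ≤ ε((log q⁺)/2)`, `ε = weilGroundEnergy`, `q⁺ = nextPrime q`; PROVED there:
`EMARGIN(0) ↔ RH`, `m ≥ 0 → EMARGIN(m) → RH`) and on three TREE theorems of the Solo programme:
`weilGroundEnergy_pos_of_riemannHypothesis` (RH ⟹ `ε(a) > 0` for all `a > 0`; Yoshida 1992 Thm 2 in variational form,
`SoloInformedNonDegenerate.lean`), `exp_neg_exp_le_weilGroundEnergy_of_riemannHypothesis` (RH ⟹ `ε(a) ≥ exp(−exp(A·a))` for `a ≥ 1`,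
`SoloInformedSizeLaw.lean` / E3) and the UNCONDITIONAL `weilGroundEnergy_exp_exp_decay` (`ε(a) ≤ C·exp(−c·e^{2a})` for `a ≥ 1`,
`SoloInformedGroundStateDecay2.lean` / T2).

WHAT THIS FILE SETTLES (§E said: «MARGIN(m) with m ≥ 0 ⟹ RH; = RH for m = 0, strictly stronger AS FAR AS KNOWN for m > 0»):
* `riemannHypothesis_iff_exists_pos_handoffEnergyMargin` — **RH ⟺ SOME strictly positive energy-margin law holds** (so «a positive
  margin» is not stronger than RH as a bare existence statement);
* `riemannHypothesis_iff_exists_handoffEnergyMargin_expexp` — **RH ⟺ ∃ A > 0, EMARGIN(m_A)** with the explicit double-exponential margin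
  `m_A(q) = exp(−exp(A · max 1 ((log q⁺)/2)))` (`= exp(−(q⁺)^{A/2})` once `q⁺ ≥ e²`; written inline, no definition): margin laws of
  double-exponential SIZE in the window are RH-EQUIVALENT;
* `weilGroundEnergy_nextPrime_le_expexp` (UNCONDITIONAL) and `HandoffEnergyMargin.le_expexp` — **every energy-margin law satisfies
  `m(q) ≤ C·exp(−c·q⁺)` for all primes `q ≥ 7`**: a margin decaying slower than simply-exponentially in `q⁺` (e.g. any power of `q`, or
  `cap(q) = (log q)/√q`) is FALSE, with no hypothesis; «strictly stronger than RH» in §E is therefore confined to the band between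
  `exp(−(q⁺)^{A/2})` and `C·e^{−c·q⁺}` — exactly the open quantitative question of the Solo size law (slope `2` vs `A` in `log log 1/ε`);
* `handoffEnergyMargin_two_sided_of_riemannHypothesis` — under RH, `exp(−(q⁺)^{A/2}) ≤ ε((log q⁺)/2) ≤ C·e^{−c·q⁺}` for all primes `q ≥ 7`.

HONEST FRAMING.  Nothing here is a step towards RH; the THRESHOLD margin `HandoffMargin m` (`m q ≤ δ*(q)`, the wall offset of the DEPRIVED form —
conj-1's C-I(b) object) is a different quantity and is NOT governed by these bounds.  The cell's measured level law «lg ε₁ ≈ −5.46·μ» (μ = e^{2t})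
is DATA of the same shape as the unconditional ceiling (slope 2 in `log log 1/ε` against the window).

References: H. Yoshida, Adv. Stud. Pure Math. 21 (1992) Thm 2 [Yoshida1992HermitianForms]; E. Bombieri, Rend. Lincei (9) 11 (2000) §4
[Bombieri2000Weil]; tree `SoloInformedSizeLaw.lean`, `SoloInformedGroundStateDecay2.lean`, `SoloInformedNonDegenerate.lean`; this track §E/§J.11.
-/

set_option linter.dupNamespace false  -- the mandated namespace repeats `RiemannHypothesis`

noncomputable section

open Set Filter Literature.NumberTheory.LFunctions
open Summit.RiemannHypothesis.RiemannHypothesis.Theorems.HandoffDecomposition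

namespace Summit.RiemannHypothesis.RiemannHypothesis.Theorems.HandoffMarginLaw

variable {m : ℕ → ℝ} {q : ℕ}

/-- The window end of a prime is a positive window: `0 < (log q⁺)/2`. [folklore] -/
theorem log_nextPrime_half_pos (q : ℕ) : 0 < Real.log (nextPrime q) / 2 := by
  have := Real.log_pos (show (1 : ℝ) < nextPrime q by exact_mod_cast (nextPrime_prime q).one_lt)
  positivity

/-- For a prime `q ≥ 7` the window end satisfies `1 ≤ (log q⁺)/2` (`q⁺ ≥ 8 > e²`). [folklore] -/
theorem one_le_log_nextPrime_half (hq : 7 ≤ q) : 1 ≤ Real.log (nextPrime q) / 2 := by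
  have h8 : (8 : ℝ) ≤ nextPrime q := by exact_mod_cast Nat.succ_le_of_lt (lt_of_le_of_lt hq (lt_nextPrime q))
  have he : Real.exp 2 ≤ 8 := by
    have := Real.exp_one_lt_d9
    have h : Real.exp 2 = Real.exp 1 * Real.exp 1 := by rw [← Real.exp_add]; norm_num
    rw [h]; nlinarith [Real.exp_pos 1]
  have hlog : 2 ≤ Real.log (nextPrime q) := by
    rw [Real.le_log_iff_exp_le (by linarith)]
    exact he.trans h8
  linarith

/-- `e^{2·((log q⁺)/2)} = q⁺`. [folklore] -/
theorem exp_two_mul_log_nextPrime_half (q : ℕ) : Real.exp (2 * (Real.log (nextPrime q) / 2)) = nextPrime q := by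
  rw [show 2 * (Real.log (nextPrime q) / 2) = Real.log (nextPrime q) by ring]
  exact Real.exp_log (by exact_mod_cast (nextPrime_prime q).pos)

/-! ## §1  A positive margin law is not stronger than RH (as an existence statement) -/

/-- **RH ⟺ some STRICTLY POSITIVE energy-margin law holds** (⇒: take `m(q) := ε((log q⁺)/2)` itself, positive under RH by the Solo
programme's `weilGroundEnergy_pos_of_riemannHypothesis`; ⇐: theory-2's `riemannHypothesis_of_handoffEnergyMargin`).
[cite: Yoshida1992HermitianForms, Thm. 2; tree SoloInformedNonDegenerate; this track (theory-1 gen4)] -/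
theorem riemannHypothesis_iff_exists_pos_handoffEnergyMargin :
    Summit.RiemannHypothesis ↔ ∃ m : ℕ → ℝ, (∀ q : ℕ, q.Prime → 0 < m q) ∧ HandoffEnergyMargin m := by
  constructor
  · intro hRH
    refine ⟨fun q ↦ weilGroundEnergy (Real.log (nextPrime q) / 2), fun q _ ↦ ?_, fun q _ ↦ le_rfl⟩
    exact Theorems.weilGroundEnergy_pos_of_riemannHypothesis (Summit.RiemannHypothesis_iff.1 hRH) (log_nextPrime_half_pos q)
  · rintro ⟨m, hm, h⟩
    exact riemannHypothesis_of_handoffEnergyMargin (fun q hq ↦ (hm q hq).le) h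

/-! ## §2  The double-exponential margin is RH-equivalent -/

/-- **RH ⟹ the double-exponential energy margin** `EMARGIN(m_A)` for some `A > 0` (the Solo programme's E3 lower size law at the window ends;
windows shorter than `1` are handled by antitonicity from the window `1`). [tree SoloInformedSizeLaw; this track (theory-1 gen4)] -/
theorem exists_handoffEnergyMargin_expexp_of_riemannHypothesis (hRH : Summit.RiemannHypothesis) :
    ∃ A : ℝ, 0 < A ∧ HandoffEnergyMargin (fun q ↦ Real.exp (-Real.exp (A * max 1 (Real.log (nextPrime q) / 2)))) := by
  obtain ⟨A, hA, h⟩ := Theorems.exp_neg_exp_le_weilGroundEnergy_of_riemannHypothesis (Summit.RiemannHypothesis_iff.1 hRH)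
  refine ⟨A, hA, fun q _ ↦ ?_⟩
  set b : ℝ := Real.log (nextPrime q) / 2 with hb
  have hb0 : 0 < b := log_nextPrime_half_pos q
  -- the bound at the window `max 1 b ≥ 1`, then antitonicity down to `b`
  have h1 := h (max 1 b) (le_max_left _ _)
  have h2 : weilGroundEnergy (max 1 b) ≤ weilGroundEnergy b := weilGroundEnergy_anti hb0 (le_max_right _ _)
  exact h1.trans h2

/-- **RH ⟺ ∃ A > 0, EMARGIN(m_A)**: energy-margin laws of double-exponential size in the window are RH-EQUIVALENT (not «strictly stronger»).
[tree SoloInformedSizeLaw; this track (theory-1 gen4)] -/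
theorem riemannHypothesis_iff_exists_handoffEnergyMargin_expexp :
    Summit.RiemannHypothesis ↔ ∃ A : ℝ, 0 < A ∧ HandoffEnergyMargin (fun q ↦ Real.exp (-Real.exp (A * max 1 (Real.log (nextPrime q) / 2)))) :=
  ⟨exists_handoffEnergyMargin_expexp_of_riemannHypothesis, fun ⟨_, _, h⟩ ↦
    riemannHypothesis_of_handoffEnergyMargin (fun _ _ ↦ (Real.exp_pos _).le) h⟩

/-! ## §3  The unconditional ceiling on any energy margin -/

/-- **UNCONDITIONAL CEILING at the window ends**: `ε((log q⁺)/2) ≤ C·exp(−c·q⁺)` for every `q ≥ 7`, with absolute `c > 0`, `C` (the Solo programme's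
T2 `weilGroundEnergy_exp_exp_decay` at `a = (log q⁺)/2`, where `e^{2a} = q⁺`). [tree SoloInformedGroundStateDecay2; this track (theory-1 gen4)] -/
theorem weilGroundEnergy_nextPrime_le_expexp :
    ∃ c : ℝ, 0 < c ∧ ∃ C : ℝ, ∀ q : ℕ, 7 ≤ q →
      weilGroundEnergy (Real.log (nextPrime q) / 2) ≤ C * Real.exp (-c * nextPrime q) := by
  obtain ⟨c, hc, C, h⟩ := Theorems.weilGroundEnergy_exp_exp_decay
  refine ⟨c, hc, C, fun q hq ↦ ?_⟩
  have := h (Real.log (nextPrime q) / 2) (one_le_log_nextPrime_half hq)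
  rwa [exp_two_mul_log_nextPrime_half] at this

/-- **Every energy-margin law is at most simply-exponentially small in `q⁺`**: `EMARGIN(m) ⟹ m(q) ≤ C·exp(−c·q⁺)` for all `q ≥ 7` — with NO
hypothesis.  So a candidate margin decaying slower than `e^{−c·q⁺}` (a power of `q`, `cap(q) = (log q)/√q`, …) is refuted outright.
[tree SoloInformedGroundStateDecay2; this track (theory-1 gen4)] -/
theorem HandoffEnergyMargin.le_expexp :
    ∃ c : ℝ, 0 < c ∧ ∃ C : ℝ, ∀ m : ℕ → ℝ, HandoffEnergyMargin m → ∀ q : ℕ, q.Prime → 7 ≤ q →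
      m q ≤ C * Real.exp (-c * nextPrime q) := by
  obtain ⟨c, hc, C, h⟩ := weilGroundEnergy_nextPrime_le_expexp
  exact ⟨c, hc, C, fun m hm q hq h7 ↦ (hm q hq).trans (h q h7)⟩

/-- **Under RH, the two-sided size of the energy margin at every prime `q ≥ 7`**:
`exp(−exp(A·(log q⁺)/2)) ≤ ε((log q⁺)/2) ≤ C·exp(−c·q⁺)` (lower: E3, RH; upper: T2, unconditional).
[tree SoloInformedSizeLaw; this track (theory-1 gen4)] -/
theorem handoffEnergyMargin_two_sided_of_riemannHypothesis (hRH : Summit.RiemannHypothesis) :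
    ∃ A c C : ℝ, 0 < A ∧ 0 < c ∧ ∀ q : ℕ, 7 ≤ q →
      Real.exp (-Real.exp (A * (Real.log (nextPrime q) / 2))) ≤ weilGroundEnergy (Real.log (nextPrime q) / 2) ∧
        weilGroundEnergy (Real.log (nextPrime q) / 2) ≤ C * Real.exp (-c * nextPrime q) := by
  obtain ⟨A, c, C, hA, hc, h⟩ :=
    Theorems.weilGroundEnergy_two_sided_of_riemannHypothesis (Summit.RiemannHypothesis_iff.1 hRH)
  refine ⟨A, c, C, hA, hc, fun q hq ↦ ?_⟩
  have := h (Real.log (nextPrime q) / 2) (one_le_log_nextPrime_half hq)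
  rwa [exp_two_mul_log_nextPrime_half] at this

end Summit.RiemannHypothesis.RiemannHypothesis.Theorems.HandoffMarginLaw

end
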